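import Mathlib
import Literature.NumberTheory.LFunctions.Zhang2022.Section15U009Line
import HarnessLib

/-!
# Zhang (2022) §15 u009 (p. 80, tex L4037), first half: the `m`-series `Σ_m k̃(m)ψ̄(Dm)(Dm)^{s−1}` —
# head/tail splitting, summability, holomorphy and the trivial bounds off the line (tools)

Topic `Literature/NumberTheory/LFunctions/Zhang2022` (Landau–Siegel audit tree; verdict-neutral).
Y. Zhang, *Discrete mean estimates and the Landau–Siegel zero*, arXiv:2211.02515v1 (2022)
[Zhang2022LandauSiegel] — **an unrefereed manuscript under adjudication; nothing here asserts or
denies its Theorems 1–2.** ZHANG-L discharge lane (helper under leaf `Typed.Section15A.Eq15_6`, node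
`Z22:§15.u009`, via the tree edge `eq15_4_of`); THEOREM-ONLY.

§15 p. 80 (tex L4037): "In a way similar to the proof of (7.3), the sum over `ψ ∈ Ψ₁` can be extended
to the sum over `ψ ∈ Ψ` …". As in the proof of (7.3) (§7 pp. 34–35: split `Σ_m` at `P²`, move the head
to `𝔍(0)` and the tail far away), the integrand `(Σ_m k̃(m)ψ̄(Dm)(Dm)^{s−1})B(s,ψ)ω(s)` of u008 on `𝔍(−1)`
is split in the REFLECTED variable `w = 1 − s`:
`Σ_m k̃(m)ψ̄(Dm)(Dm)^{s−1} = ψ̄(D)D^{−w}·(Σ_{m≤X} k̃(m)ψ̄(m)m^{−w} + Σ_{m>X} k̃(m)ψ̄(m)m^{−w})`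
(`ktildeSeries_eq_head_add_tail`), the tail written as the `LSeries` of `m ↦ [X < m]k̃(m)ψ̄(m)` —
`LSeries`-summable and holomorphic on `Re w > 1` (i.e. `Re s < 0`), of size `≤ S₄(X+1)^{3/2−Re w}` for
`Re w ≥ 3/2` (`norm_LSeries_ktilde_tail_le`, `S₄ = Σ_m τ₄(m)m^{−3/2}`, `|k̃| ≤ τ₄` by
`Typed.Section15A.norm_ktilde_le`); the head is an entire finite sum. Also: the crude bounds
`‖B(s,ψ)‖ ≤ C_b⌈PT⁻²⌉²·⌈PT⁻²⌉^{−σ}` (`σ ≤ 0`) and `‖B(s,ψ)‖ ≤ C_b⌈PT⁻²⌉³` (`σ ≥ −1/2`) from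
(15.1)–(15.2). Mirror image of the tree's `Section14Eq143TailBounds` (the (14.3) instance of (7.3)).

## References

* Y. Zhang, arXiv:2211.02515v1 (2022), §15 p. 80, tex L4029–L4041; §7 pp. 34–35, tex L1874–L1899.
  [cite: Zhang2022LandauSiegel, §15 p. 80]
-/

noncomputable section

open Complex Real
open scoped ComplexConjugate

namespace Literature.NumberTheory.LFunctions.Zhang2022.Typed.Section15A.U009

open Skeleton

variable (c' : ℝ) {D : ℕ}

/-! ### The reflected coefficient series `Σ_m k̃(m)ψ̄(m)m^{−w}` -/

/-- Termwise bound: `|k̃(m)ψ̄(m)m^{−w}| ≤ τ₄(m)m^{−Re w}` (`log D > 0`).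
[cite: Zhang2022LandauSiegel, §15 p. 80, tex L4029] -/
theorem norm_ktilde_twist_term_le (x : Chr D) (hℓ : 0 < ell D) (w : ℂ) (m : ℕ) :
    ‖ktilde c' D m * conj (x.ψ (m : ZMod x.p)) * (m : ℂ) ^ (-w)‖ ≤
      MeanSquareMajorant.tau 4 m * (m : ℝ) ^ (-w.re) := by
  rcases Nat.eq_zero_or_pos m with rfl | hm
  · have h0 : x.ψ ((0 : ℕ) : ZMod x.p) = 0 := by rw [Nat.cast_zero, MulChar.map_zero]
    rw [h0, map_zero, mul_zero, zero_mul, norm_zero]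
    exact mul_nonneg (MeanSquareMajorant.tau_nonneg 4 0) (Real.rpow_nonneg (Nat.cast_nonneg 0) _)
  · rw [norm_mul, norm_mul, Complex.norm_conj, Complex.norm_natCast_cpow_of_pos hm, Complex.neg_re]
    have h1 : ‖ktilde c' D m‖ ≤ MeanSquareMajorant.tau 4 m := norm_ktilde_le c' hℓ m
    have h2 : ‖x.ψ (m : ZMod x.p)‖ ≤ 1 := DirichletCharacter.norm_le_one _ _
    calc ‖ktilde c' D m‖ * ‖x.ψ (m : ZMod x.p)‖ * (m : ℝ) ^ (-w.re)
        ≤ MeanSquareMajorant.tau 4 m * 1 * (m : ℝ) ^ (-w.re) :=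
          mul_le_mul_of_nonneg_right (mul_le_mul h1 h2 (norm_nonneg _)
            (MeanSquareMajorant.tau_nonneg 4 m)) (Real.rpow_nonneg (Nat.cast_nonneg m) _)
      _ = MeanSquareMajorant.tau 4 m * (m : ℝ) ^ (-w.re) := by ring

/-- **Absolute convergence for `Re w > 1`** of `Σ_m k̃(m)ψ̄(m)m^{−w}` (u007: `k̃ ≪ τ₄`).
[cite: Zhang2022LandauSiegel, §15 p. 80, tex L4029] -/
theorem summable_ktilde_twist (x : Chr D) (hℓ : 0 < ell D) {w : ℂ} (hw : 1 < w.re) :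
    Summable fun m : ℕ => ktilde c' D m * conj (x.ψ (m : ZMod x.p)) * (m : ℂ) ^ (-w) :=
  Summable.of_norm_bounded (MeanSquareMajorant.summable_tau_mul_rpow_neg 4 hw)
    (norm_ktilde_twist_term_le c' x hℓ w)

/-- The `LSeries` terms of the tail sequence `m ↦ [X < m]k̃(m)ψ̄(m)` are the terms `m > X` of the
series. [cite: Zhang2022LandauSiegel, §7 p. 34, tex L1877] -/
theorem term_ktilde_tail_eq (x : Chr D) (X : ℕ) (w : ℂ) (m : ℕ) :
    LSeries.term (fun m : ℕ => if X < m then ktilde c' D m * conj (x.ψ (m : ZMod x.p)) else 0) w m =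
      if X < m then ktilde c' D m * conj (x.ψ (m : ZMod x.p)) * (m : ℂ) ^ (-w) else 0 := by
  rcases Nat.eq_zero_or_pos m with rfl | hm
  · rw [LSeries.term_zero, if_neg (Nat.not_lt_zero X)]
  · rw [LSeries.term_of_ne_zero hm.ne']
    split_ifs
    · rw [Complex.cpow_neg, div_eq_mul_inv]
    · rw [zero_div]

/-- The tail sequence is `LSeries`-summable for `Re w > 1`. [cite: Zhang2022LandauSiegel, §7 p. 34, tex L1878] -/
theorem LSeriesSummable_ktilde_tail (x : Chr D) (hℓ : 0 < ell D) (X : ℕ) {w : ℂ} (hw : 1 < w.re) :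
    LSeriesSummable (fun m : ℕ => if X < m then ktilde c' D m * conj (x.ψ (m : ZMod x.p)) else 0) w := by
  unfold LSeriesSummable
  rw [show LSeries.term (fun m : ℕ => if X < m then ktilde c' D m * conj (x.ψ (m : ZMod x.p)) else 0) w =
      fun m => if X < m then ktilde c' D m * conj (x.ψ (m : ZMod x.p)) * (m : ℂ) ^ (-w) else 0 from
    funext (term_ktilde_tail_eq c' x X w)]
  refine Summable.of_norm_bounded (MeanSquareMajorant.summable_tau_mul_rpow_neg 4 hw) fun m => ?_
  split_ifs
  · exact norm_ktilde_twist_term_le c' x hℓ w m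
  · rw [norm_zero]
    exact le_trans (norm_nonneg _) (norm_ktilde_twist_term_le c' x hℓ w m)

/-- **Splitting at `X`**: for `Re w > 1`,
`Σ_m k̃(m)ψ̄(m)m^{−w} = Σ_{1≤m≤X} k̃(m)ψ̄(m)m^{−w} + Σ_{m>X} k̃(m)ψ̄(m)m^{−w}`, the tail as an `LSeries`.
[cite: Zhang2022LandauSiegel, §7 p. 34, tex L1877; §15 p. 80, tex L4037] -/
theorem tsum_ktilde_twist_eq_head_add_LSeries (x : Chr D) (hℓ : 0 < ell D) (X : ℕ) {w : ℂ}
    (hw : 1 < w.re) :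
    ∑' m : ℕ, ktilde c' D m * conj (x.ψ (m : ZMod x.p)) * (m : ℂ) ^ (-w) =
      ∑ m ∈ Finset.Icc 1 X, ktilde c' D m * conj (x.ψ (m : ZMod x.p)) * (m : ℂ) ^ (-w) +
        LSeries (fun m : ℕ => if X < m then ktilde c' D m * conj (x.ψ (m : ZMod x.p)) else 0) w := by
  set f : ℕ → ℂ := fun m => ktilde c' D m * conj (x.ψ (m : ZMod x.p)) * (m : ℂ) ^ (-w) with hf
  have hsum : Summable f := summable_ktilde_twist c' x hℓ hw
  have hsplit : ∀ m, f m = (if m ≤ X then f m else 0) + (if X < m then f m else 0) := by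
    intro m
    by_cases h : m ≤ X
    · rw [if_pos h, if_neg (not_lt.mpr h), add_zero]
    · rw [if_neg h, if_pos (not_le.mp h), zero_add]
  have h1 : Summable fun m => if m ≤ X then f m else 0 := by
    refine summable_of_ne_finset_zero (s := Finset.range (X + 1)) fun m hm => ?_
    rw [Finset.mem_range, not_lt] at hm
    exact if_neg (by omega)
  have h2 : Summable fun m => if X < m then f m else 0 := by
    have := LSeriesSummable_ktilde_tail c' x hℓ X hw
    unfold LSeriesSummable at this
    rwa [show LSeries.term (fun m : ℕ => if X < m then ktilde c' D m * conj (x.ψ (m : ZMod x.p)) else 0) w =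
        fun m => if X < m then ktilde c' D m * conj (x.ψ (m : ZMod x.p)) * (m : ℂ) ^ (-w) else 0 from
      funext (term_ktilde_tail_eq c' x X w)] at this
  have hf0 : f 0 = 0 := by
    rw [hf]; simp only [Nat.cast_zero, MulChar.map_zero, map_zero, mul_zero, zero_mul]
  rw [LSeries]
  simp_rw [term_ktilde_tail_eq]
  calc ∑' m, f m = ∑' m, ((if m ≤ X then f m else 0) + (if X < m then f m else 0)) :=
        tsum_congr hsplit
    _ = ∑' m, (if m ≤ X then f m else 0) + ∑' m, (if X < m then f m else 0) := h1.tsum_add h2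
    _ = ∑ m ∈ Finset.Icc 1 X, f m + ∑' m, (if X < m then f m else 0) := by
        congr 1
        rw [tsum_eq_sum (s := Finset.range (X + 1)) fun m hm => by
          rw [Finset.mem_range, not_lt] at hm; exact if_neg (by omega)]
        rw [Finset.sum_congr rfl fun m hm => if_pos (by
          have := Finset.mem_range.mp hm; omega), Finset.range_eq_Ico]
        have e : Finset.Ico 0 (X + 1) = insert 0 (Finset.Icc 1 X) := by
          ext m; simp only [Finset.mem_Ico, Finset.mem_insert, Finset.mem_Icc]; omega
        rw [e, Finset.sum_insert (by simp)]
        simp only [hf] at hf0 ⊢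
        rw [hf0, zero_add]

/-- **The head/tail splitting of `Σ_m k̃(m)ψ̄(Dm)(Dm)^{s−1}` in the reflected variable `w = 1 − s`**
(`Re s < 0`): `ktildeSeries = ψ̄(D)D^{−(1−s)}·(Σ_{m≤X} k̃(m)ψ̄(m)m^{−(1−s)} + Σ_{m>X} …)` — by
`ψ̄(Dm) = ψ̄(D)ψ̄(m)`, `(Dm)^{−(1−s)} = D^{−(1−s)}m^{−(1−s)}` and the splitting at `X`.
[cite: Zhang2022LandauSiegel, §15 p. 80, tex L4037] -/
theorem ktildeSeries_eq_head_add_tail (x : Chr D) (hℓ : 0 < ell D) (X : ℕ) {s : ℂ} (hs : s.re < 0) :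
    ktildeSeries c' x s =
      conj (x.ψ (D : ZMod x.p)) * (D : ℂ) ^ (-(1 - s)) *
        (∑ m ∈ Finset.Icc 1 X, ktilde c' D m * conj (x.ψ (m : ZMod x.p)) * (m : ℂ) ^ (-(1 - s)) +
          LSeries (fun m : ℕ => if X < m then ktilde c' D m * conj (x.ψ (m : ZMod x.p)) else 0)
            (1 - s)) := by
  have hw : 1 < (1 - s).re := by simp only [sub_re, one_re]; linarith
  rw [← tsum_ktilde_twist_eq_head_add_LSeries c' x hℓ X hw, ktildeSeries, ← tsum_mul_left]
  refine tsum_congr fun m => ?_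
  have hD : ((D * m : ℕ) : ℂ) ^ (1 - s) = (D : ℂ) ^ (1 - s) * (m : ℂ) ^ (1 - s) := by
    rw [Nat.cast_mul, Complex.natCast_mul_natCast_cpow]
  have hψ : conj (x.ψ ((D * m : ℕ) : ZMod x.p)) =
      conj (x.ψ (D : ZMod x.p)) * conj (x.ψ (m : ZMod x.p)) := by
    rw [Nat.cast_mul, map_mul, map_mul]
  rw [hD, hψ, Complex.cpow_neg, Complex.cpow_neg, div_eq_mul_inv, mul_inv]
  ring

/-- **The tail `LSeries` is holomorphic on `Re w > 1`** (its abscissa of absolute convergence is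
`≤ 1`). [cite: Zhang2022LandauSiegel, §7 p. 35, tex L1890] -/
theorem differentiableOn_LSeries_ktilde_tail (x : Chr D) (hℓ : 0 < ell D) (X : ℕ) :
    DifferentiableOn ℂ
      (LSeries fun m : ℕ => if X < m then ktilde c' D m * conj (x.ψ (m : ZMod x.p)) else 0)
      {w : ℂ | 1 < w.re} := by
  have habs : LSeries.abscissaOfAbsConv
      (fun m : ℕ => if X < m then ktilde c' D m * conj (x.ψ (m : ZMod x.p)) else 0) ≤ (1 : ℝ) :=
    LSeries.abscissaOfAbsConv_le_of_forall_lt_LSeriesSummable fun y hy =>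
      LSeriesSummable_ktilde_tail c' x hℓ X (by simpa using hy)
  refine (LSeries_differentiableOn _).mono fun w hw => ?_
  exact lt_of_le_of_lt habs (by exact_mod_cast hw)

/-- The head `Σ_{1≤m≤X} k̃(m)ψ̄(m)m^{−w}` is entire. [cite: Zhang2022LandauSiegel, §7 p. 34, tex L1877] -/
theorem differentiable_ktilde_head (x : Chr D) (X : ℕ) :
    Differentiable ℂ fun w : ℂ =>
      ∑ m ∈ Finset.Icc 1 X, ktilde c' D m * conj (x.ψ (m : ZMod x.p)) * (m : ℂ) ^ (-w) := by
  refine Differentiable.fun_sum fun m hm => ?_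
  have hm1 : (m : ℂ) ≠ 0 := Nat.cast_ne_zero.mpr (by have := (Finset.mem_Icc.mp hm).1; omega)
  exact (differentiable_const _).mul (differentiable_id.neg.const_cpow (Or.inl hm1))

/-! ### The trivial bounds -/

/-- **Rankin-type bound for the tail on `Re w ≥ 3/2`**: `|Σ_{m>X} k̃(m)ψ̄(m)m^{−w}| ≤ S₄·(X+1)^{3/2−Re w}`,
`S₄ = Σ_m τ₄(m)m^{−3/2}` (termwise `m^{−Re w} ≤ (X+1)^{3/2−Re w}m^{−3/2}` for `m > X`).
[cite: Zhang2022LandauSiegel, §7 p. 34, tex L1878; §15 p. 80, tex L4037] -/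
theorem norm_LSeries_ktilde_tail_le (x : Chr D) (hℓ : 0 < ell D) (X : ℕ) {w : ℂ} (hw : 3 / 2 ≤ w.re) :
    ‖LSeries (fun m : ℕ => if X < m then ktilde c' D m * conj (x.ψ (m : ZMod x.p)) else 0) w‖ ≤
      (∑' m : ℕ, MeanSquareMajorant.tau 4 m * (m : ℝ) ^ (-(3 / 2 : ℝ))) *
        ((X : ℝ) + 1) ^ (3 / 2 - w.re) := by
  have hsum := MeanSquareMajorant.summable_tau_mul_rpow_neg 4 (σ := 3 / 2) (by norm_num)
  set S : ℝ := ∑' m : ℕ, MeanSquareMajorant.tau 4 m * (m : ℝ) ^ (-(3 / 2 : ℝ)) with hSdef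
  set σ := w.re with hσ
  set Y : ℝ := (X : ℝ) + 1 with hY
  have hY0 : 0 < Y := by positivity
  set g : ℕ → ℝ := fun m => Y ^ (3 / 2 - σ) * (MeanSquareMajorant.tau 4 m * (m : ℝ) ^ (-(3 / 2 : ℝ)))
    with hg
  have hg_summ : Summable g := hsum.mul_left _
  have hK0 : 0 ≤ Y ^ (3 / 2 - σ) := Real.rpow_nonneg hY0.le _
  have hg0 : ∀ m, 0 ≤ g m := fun m => mul_nonneg hK0
    (mul_nonneg (MeanSquareMajorant.tau_nonneg 4 m) (Real.rpow_nonneg (Nat.cast_nonneg m) _))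
  have hf : ∀ m : ℕ,
      ‖(if X < m then ktilde c' D m * conj (x.ψ (m : ZMod x.p)) * (m : ℂ) ^ (-w) else 0)‖ ≤ g m := by
    intro m
    split_ifs with hm
    · have hm0 : 0 < m := by omega
      have hmY : Y ≤ m := by rw [hY]; exact_mod_cast hm
      have hm0' : (0 : ℝ) < m := by exact_mod_cast hm0
      refine (norm_ktilde_twist_term_le c' x hℓ w m).trans ?_
      rw [hg, ← hσ]
      have h2 : (m : ℝ) ^ (-σ) ≤ Y ^ (3 / 2 - σ) * (m : ℝ) ^ (-(3 / 2 : ℝ)) := by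
        rw [show -σ = -(σ - 3 / 2) + -(3 / 2 : ℝ) by ring, Real.rpow_add hm0',
          show (3 / 2 : ℝ) - σ = -(σ - 3 / 2) by ring]
        exact mul_le_mul_of_nonneg_right
          (Real.rpow_le_rpow_of_nonpos hY0 hmY (by linarith)) (Real.rpow_nonneg hm0'.le _)
      calc MeanSquareMajorant.tau 4 m * (m : ℝ) ^ (-σ)
          ≤ MeanSquareMajorant.tau 4 m * (Y ^ (3 / 2 - σ) * (m : ℝ) ^ (-(3 / 2 : ℝ))) :=
            mul_le_mul_of_nonneg_left h2 (MeanSquareMajorant.tau_nonneg 4 m)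
        _ = Y ^ (3 / 2 - σ) * (MeanSquareMajorant.tau 4 m * (m : ℝ) ^ (-(3 / 2 : ℝ))) := by ring
    · rw [norm_zero]; exact hg0 m
  have hsumm : Summable fun m : ℕ =>
      ‖(if X < m then ktilde c' D m * conj (x.ψ (m : ZMod x.p)) * (m : ℂ) ^ (-w) else 0)‖ :=
    Summable.of_nonneg_of_le (fun _ => norm_nonneg _) hf hg_summ
  rw [LSeries]
  simp_rw [term_ktilde_tail_eq]
  calc ‖∑' m : ℕ, (if X < m then ktilde c' D m * conj (x.ψ (m : ZMod x.p)) * (m : ℂ) ^ (-w) else 0)‖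
      ≤ ∑' m : ℕ, ‖(if X < m then ktilde c' D m * conj (x.ψ (m : ZMod x.p)) * (m : ℂ) ^ (-w) else 0)‖ :=
        norm_tsum_le_tsum_norm hsumm
    _ ≤ ∑' m : ℕ, g m := Summable.tsum_le_tsum hf hsumm hg_summ
    _ = Y ^ (3 / 2 - σ) * S := by rw [hSdef, ← tsum_mul_left]
    _ = S * Y ^ (3 / 2 - σ) := by ring

/-- `τ_{j+1}(n) ≤ n^j` for `n ≥ 1` (crude: `#{d ∣ n} ≤ n`). [folklore] -/
private theorem tau_succ_le_pow (j : ℕ) : ∀ {n : ℕ}, n ≠ 0 →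
    MeanSquareMajorant.tau (j + 1) n ≤ (n : ℝ) ^ j := by
  induction j with
  | zero => intro n hn; rw [MeanSquareMajorant.tau_one_apply hn, pow_zero]
  | succ j ih =>
    intro n hn
    rw [MeanSquareMajorant.tau_succ_apply]
    calc ∑ d ∈ n.divisors, MeanSquareMajorant.tau (j + 1) d ≤ ∑ d ∈ n.divisors, (n : ℝ) ^ j := by
          refine Finset.sum_le_sum fun d hd => ?_
          have hd0 : d ≠ 0 := (Nat.pos_of_mem_divisors hd).ne'
          have hdn : (d : ℝ) ≤ n := by exact_mod_cast Nat.divisor_le hd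
          exact (ih hd0).trans (pow_le_pow_left₀ (Nat.cast_nonneg d) hdn j)
      _ = (n.divisors.card : ℝ) * (n : ℝ) ^ j := by rw [Finset.sum_const, nsmul_eq_mul]
      _ ≤ (n : ℝ) * (n : ℝ) ^ j := by
          gcongr; exact_mod_cast Nat.card_divisors_le_self n
      _ = (n : ℝ) ^ (j + 1) := by ring

/-- **Trivial bound for the head on `Re w ≥ 1/2`**: `|Σ_{m≤X} k̃(m)ψ̄(m)m^{−w}| ≤ X⁴`
(`|k̃(m)| ≤ τ₄(m) ≤ m³ ≤ X³`, `|m^{−w}| ≤ 1`). [cite: Zhang2022LandauSiegel, §7 p. 35, tex L1893] -/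
theorem norm_ktilde_head_le_crude (x : Chr D) (hℓ : 0 < ell D) (X : ℕ) {w : ℂ} (hw : 0 ≤ w.re) :
    ‖∑ m ∈ Finset.Icc 1 X, ktilde c' D m * conj (x.ψ (m : ZMod x.p)) * (m : ℂ) ^ (-w)‖ ≤
      (X : ℝ) ^ 4 := by
  calc ‖∑ m ∈ Finset.Icc 1 X, ktilde c' D m * conj (x.ψ (m : ZMod x.p)) * (m : ℂ) ^ (-w)‖
      ≤ ∑ m ∈ Finset.Icc 1 X, ‖ktilde c' D m * conj (x.ψ (m : ZMod x.p)) * (m : ℂ) ^ (-w)‖ :=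
        norm_sum_le _ _
    _ ≤ ∑ m ∈ Finset.Icc 1 X, (X : ℝ) ^ 3 := by
        refine Finset.sum_le_sum fun m hm => ?_
        have hm1 : 1 ≤ m := (Finset.mem_Icc.mp hm).1
        have hmX : m ≤ X := (Finset.mem_Icc.mp hm).2
        refine (norm_ktilde_twist_term_le c' x hℓ w m).trans ?_
        have h1 : MeanSquareMajorant.tau 4 m ≤ (X : ℝ) ^ 3 :=
          (tau_succ_le_pow 3 (by omega)).trans (pow_le_pow_left₀ (Nat.cast_nonneg _) (Nat.cast_le.mpr hmX) 3)
        have h2 : (m : ℝ) ^ (-w.re) ≤ 1 :=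
          Real.rpow_le_one_of_one_le_of_nonpos (by exact_mod_cast hm1) (by linarith)
        calc MeanSquareMajorant.tau 4 m * (m : ℝ) ^ (-w.re) ≤ (X : ℝ) ^ 3 * 1 :=
              mul_le_mul h1 h2 (Real.rpow_nonneg (Nat.cast_nonneg m) _) (pow_nonneg (Nat.cast_nonneg _) 3)
          _ = (X : ℝ) ^ 3 := mul_one _
    _ = (X : ℝ) * (X : ℝ) ^ 3 := by rw [Finset.sum_const, Nat.card_Icc, nsmul_eq_mul]; simp
    _ = (X : ℝ) ^ 4 := by ring

/-- `|χψ(n)| ≤ 1`. [cite: Zhang2022LandauSiegel, §2 (2.23)] -/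
private theorem norm_pc_le_one [NeZero D] (χ : DirichletCharacter ℂ D) (x : Chr D) (n : ℕ) :
    ‖pc χ x n‖ ≤ 1 := by
  rw [pc, norm_mul]
  calc ‖x.ψ (n : ZMod x.p)‖ * ‖χ (n : ZMod D)‖ ≤ 1 * 1 :=
        mul_le_mul (DirichletCharacter.norm_le_one _ _) (DirichletCharacter.norm_le_one _ _)
          (norm_nonneg _) zero_le_one
    _ = 1 := mul_one _

/-- **`‖B(s,ψ)‖ ≤ C_b⌈PT⁻²⌉²·⌈PT⁻²⌉^{−σ}` for `σ = Re s ≤ 0`** (`C_b = (1+|ι₂|)(|ι₃|+|ι₄|)`; (15.1)–(15.2):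
`< ⌈PT⁻²⌉` terms of modulus `≤ C_bτ₂(n)n^{−σ} ≤ C_b·⌈PT⁻²⌉·⌈PT⁻²⌉^{−σ}`), for `𝓛 ≥ 3`.
[cite: Zhang2022LandauSiegel, §15 (15.1)–(15.2) p. 79] -/
theorem norm_Bpoly_le_of_re_nonpos [NeZero D] (χ : DirichletCharacter ℂ D) (x : Chr D)
    (hℓ : 3 ≤ ell D) {s : ℂ} (hs : s.re ≤ 0) :
    ‖Bpoly χ x s‖ ≤ (1 + ‖iota2‖) * (‖iota3‖ + ‖iota4‖) * (⌈bigP D / bigT D ^ 2⌉₊ : ℝ) ^ 2 *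
      (⌈bigP D / bigT D ^ 2⌉₊ : ℝ) ^ (-s.re) := by
  set N : ℕ := ⌈bigP D / bigT D ^ 2⌉₊ with hN
  set Cb : ℝ := (1 + ‖iota2‖) * (‖iota3‖ + ‖iota4‖) with hCb
  have hCb0 : 0 ≤ Cb := by positivity
  have hℓ2 : 2 ≤ Real.log D := by have : ell D = Real.log D := rfl; linarith
  have hNσ : 0 ≤ (N : ℝ) ^ (-s.re) := Real.rpow_nonneg (Nat.cast_nonneg N) _
  rw [Bpoly_eq_sum_bcoef χ x hℓ (N := N) (Nat.le_ceil _) s]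
  have hterm : ∀ n ∈ Finset.range N,
      ‖bcoef D n * pc χ x n * (n : ℂ) ^ (-s)‖ ≤ Cb * (N : ℝ) * (N : ℝ) ^ (-s.re) := by
    intro n hn
    have hnN : n < N := Finset.mem_range.mp hn
    rcases Nat.eq_zero_or_pos n with rfl | hn0
    · rw [show pc χ x 0 = 0 by rw [pc, Nat.cast_zero, MulChar.map_zero, zero_mul], mul_zero,
        zero_mul, norm_zero]
      positivity
    rw [norm_mul, norm_mul, Complex.norm_natCast_cpow_of_pos hn0, Complex.neg_re]
    have h1 : ‖bcoef D n‖ ≤ Cb * MeanSquareMajorant.tau 2 n := norm_bcoef_le hℓ2 n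
    have h3 : (n : ℝ) ^ (-s.re) ≤ (N : ℝ) ^ (-s.re) :=
      Real.rpow_le_rpow (Nat.cast_nonneg n) (by exact_mod_cast hnN.le) (by linarith)
    have h4 : MeanSquareMajorant.tau 2 n ≤ (N : ℝ) := by
      rw [MeanSquareMajorant.tau_two_apply]
      exact_mod_cast (Nat.card_divisors_le_self n).trans hnN.le
    have hCt : 0 ≤ Cb * MeanSquareMajorant.tau 2 n := mul_nonneg hCb0 (MeanSquareMajorant.tau_nonneg 2 n)
    calc ‖bcoef D n‖ * ‖pc χ x n‖ * (n : ℝ) ^ (-s.re) ≤ (Cb * MeanSquareMajorant.tau 2 n) * 1 * (N : ℝ) ^ (-s.re) :=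
          mul_le_mul (mul_le_mul h1 (norm_pc_le_one χ x n) (norm_nonneg _) hCt) h3
            (Real.rpow_nonneg (Nat.cast_nonneg n) _) (by rw [mul_one]; exact hCt)
      _ ≤ Cb * N * 1 * (N : ℝ) ^ (-s.re) :=
          mul_le_mul_of_nonneg_right (mul_le_mul_of_nonneg_right
            (mul_le_mul_of_nonneg_left h4 hCb0) zero_le_one) hNσ
      _ = Cb * (N : ℝ) * (N : ℝ) ^ (-s.re) := by ring
  calc ‖∑ n ∈ Finset.range N, bcoef D n * pc χ x n * (n : ℂ) ^ (-s)‖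
      ≤ ∑ n ∈ Finset.range N, ‖bcoef D n * pc χ x n * (n : ℂ) ^ (-s)‖ := norm_sum_le _ _
    _ ≤ ∑ n ∈ Finset.range N, Cb * (N : ℝ) * (N : ℝ) ^ (-s.re) := Finset.sum_le_sum hterm
    _ = (N : ℝ) * (Cb * (N : ℝ) * (N : ℝ) ^ (-s.re)) := by
        rw [Finset.sum_const, Finset.card_range, nsmul_eq_mul]
    _ = Cb * (N : ℝ) ^ 2 * (N : ℝ) ^ (-s.re) := by ring

/-- **`‖B(s,ψ)‖ ≤ C_b⌈PT⁻²⌉³` for `Re s ≥ −1/2`** (in fact for `Re s ≥ −1`; terms of modulus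
`≤ C_bτ₂(n)n^{−σ} ≤ C_b·n·n`), for `𝓛 ≥ 3`. [cite: Zhang2022LandauSiegel, §15 (15.1)–(15.2) p. 79] -/
theorem norm_Bpoly_le_of_neg_half_le_re [NeZero D] (χ : DirichletCharacter ℂ D) (x : Chr D)
    (hℓ : 3 ≤ ell D) {s : ℂ} (hs1 : -1 / 2 ≤ s.re) :
    ‖Bpoly χ x s‖ ≤ (1 + ‖iota2‖) * (‖iota3‖ + ‖iota4‖) * (⌈bigP D / bigT D ^ 2⌉₊ : ℝ) ^ 3 := by
  set N : ℕ := ⌈bigP D / bigT D ^ 2⌉₊ with hN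
  set Cb : ℝ := (1 + ‖iota2‖) * (‖iota3‖ + ‖iota4‖) with hCb
  have hCb0 : 0 ≤ Cb := by positivity
  have hℓ2 : 2 ≤ Real.log D := by have : ell D = Real.log D := rfl; linarith
  rw [Bpoly_eq_sum_bcoef χ x hℓ (N := N) (Nat.le_ceil _) s]
  have hterm : ∀ n ∈ Finset.range N, ‖bcoef D n * pc χ x n * (n : ℂ) ^ (-s)‖ ≤ Cb * (N : ℝ) ^ 2 := by
    intro n hn
    have hnN : n < N := Finset.mem_range.mp hn
    rcases Nat.eq_zero_or_pos n with rfl | hn0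
    · rw [show pc χ x 0 = 0 by rw [pc, Nat.cast_zero, MulChar.map_zero, zero_mul], mul_zero,
        zero_mul, norm_zero]
      positivity
    rw [norm_mul, norm_mul, Complex.norm_natCast_cpow_of_pos hn0, Complex.neg_re]
    have h1 : ‖bcoef D n‖ ≤ Cb * MeanSquareMajorant.tau 2 n := norm_bcoef_le hℓ2 n
    have hn1 : (1 : ℝ) ≤ n := by exact_mod_cast hn0
    have h3 : (n : ℝ) ^ (-s.re) ≤ (N : ℝ) := by
      calc (n : ℝ) ^ (-s.re) ≤ (n : ℝ) ^ (1 : ℝ) := Real.rpow_le_rpow_of_exponent_le hn1 (by linarith)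
        _ = n := Real.rpow_one _
        _ ≤ N := by exact_mod_cast hnN.le
    have h4 : MeanSquareMajorant.tau 2 n ≤ (N : ℝ) := by
      rw [MeanSquareMajorant.tau_two_apply]
      exact_mod_cast (Nat.card_divisors_le_self n).trans hnN.le
    have hCt : 0 ≤ Cb * MeanSquareMajorant.tau 2 n := mul_nonneg hCb0 (MeanSquareMajorant.tau_nonneg 2 n)
    calc ‖bcoef D n‖ * ‖pc χ x n‖ * (n : ℝ) ^ (-s.re) ≤ (Cb * MeanSquareMajorant.tau 2 n) * 1 * N :=
          mul_le_mul (mul_le_mul h1 (norm_pc_le_one χ x n) (norm_nonneg _) hCt) h3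
            (Real.rpow_nonneg (Nat.cast_nonneg n) _) (by rw [mul_one]; exact hCt)
      _ ≤ Cb * N * 1 * N :=
          mul_le_mul_of_nonneg_right (mul_le_mul_of_nonneg_right
            (mul_le_mul_of_nonneg_left h4 hCb0) zero_le_one) (Nat.cast_nonneg N)
      _ = Cb * (N : ℝ) ^ 2 := by ring
  calc ‖∑ n ∈ Finset.range N, bcoef D n * pc χ x n * (n : ℂ) ^ (-s)‖
      ≤ ∑ n ∈ Finset.range N, ‖bcoef D n * pc χ x n * (n : ℂ) ^ (-s)‖ := norm_sum_le _ _
    _ ≤ ∑ n ∈ Finset.range N, Cb * (N : ℝ) ^ 2 := Finset.sum_le_sum hterm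
    _ = (N : ℝ) * (Cb * (N : ℝ) ^ 2) := by rw [Finset.sum_const, Finset.card_range, nsmul_eq_mul]
    _ = Cb * (N : ℝ) ^ 3 := by ring

/-- **`⌈PT⁻²⌉ ≤ P`** for `𝓛 ≥ 2` (`T² ≥ e² ≥ 2`, so `PT⁻² + 1 ≤ P/2 + 1 ≤ P` as `P ≥ e^{512} ≥ 2`).
[cite: Zhang2022LandauSiegel, §2 (2.6), §6 (the parameter `T`)] -/
theorem ceil_PT2_le_bigP (hℓ : 2 ≤ ell D) : (⌈bigP D / bigT D ^ 2⌉₊ : ℝ) ≤ bigP D := by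
  have hℓ0 : 0 < ell D := by linarith
  have hP : 0 < bigP D := Real.exp_pos _
  have hT2 : 2 ≤ bigT D ^ 2 := by
    have h1 : (1 : ℝ) ≤ ell D ^ (1.1 : ℝ) := Real.one_le_rpow (by linarith) (by norm_num)
    have h2 : 2 ≤ bigT D := by
      rw [bigT]; have := Real.add_one_le_exp (ell D ^ (1.1 : ℝ)); linarith
    nlinarith
  have hP2 : 2 ≤ bigP D := by
    rw [bigP]
    have h9 : (2 : ℝ) ≤ ell D ^ 9 := by
      calc (2 : ℝ) ≤ 2 ^ 9 := by norm_num
        _ ≤ ell D ^ 9 := pow_le_pow_left₀ (by norm_num) hℓ 9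
    have := Real.add_one_le_exp (ell D ^ 9); linarith
  have h1 : (⌈bigP D / bigT D ^ 2⌉₊ : ℝ) < bigP D / bigT D ^ 2 + 1 := Nat.ceil_lt_add_one (by positivity)
  have h2 : bigP D / bigT D ^ 2 ≤ bigP D / 2 := div_le_div_of_nonneg_left hP.le (by norm_num) hT2
  linarith

end Literature.NumberTheory.LFunctions.Zhang2022.Typed.Section15A.U009
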